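import Summits.RiemannHypothesis.RiemannHypothesis.Theorems.ScrewManifestCornerGap
import Summits.RiemannHypothesis.RiemannHypothesis.Theorems.ZetaScrewTopSecondDifference
import HarnessLib

/-!
# RH-FREE: the lag-density slot `Manifest.LagDensity` (L3 of `ScrewManifestCornerGap`) holds

`LagDensity` (sos-theory g19, `Theorems/ScrewManifestCornerGap.lean`): for every `δ > 0` and all large
`n`, every `x ∈ [1, 3]` is within `δ` of a scaled near lag `(n+1)·(node i − node j)` of the truncated
screw matrix (`node i = log(i+2)`), with `j` in the top half (`n + 1 ≤ 2(j+2)`), `j < i ≤ j + 6`.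

Proof (elementary, `lagDensity_holds`, threshold `M₀ = ⌈16/δ⌉₊ + 8`): write `N = n + 1` and `q = j + 2`.
One-step lags `N·log((q+1)/q) ∈ [N/(q+1), N/q]` (`lag_one_step`) and two-step lags
`N·log((q+2)/q) ∈ [2N/(q+2), 2N/q]` (`lag_two_step`) with `N/2 ≤ q` cover `[1, 3]` with mesh `≤ 16/N`:
`x < N/(N−1)`: `q = N − 1` (one step); `N/(N−1) ≤ x ≤ 2`: `q = ⌈N/x⌉₊` (one step);
`2 < x < 2N/(N−2)`: `q = ⌈N/2⌉₊` (one step); `2N/(N−2) ≤ x ≤ 3`: `q = ⌈2N/x⌉₊` (two steps).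
The log brackets are `1 − 1/u ≤ log u ≤ u − 1` (`log_div_sub_one_mem` of `ZetaScrewTopSecondDifference`).

RH-FREE: a statement about the logarithms of consecutive integers; nothing here bears on the truth of RH.
References: [folklore].
-/

set_option linter.dupNamespace false
set_option autoImplicit false

noncomputable section

open Real Set

namespace Summit.RiemannHypothesis.RiemannHypothesis.Theorems.IntegerScrew.Manifest

open Literature.NumberTheory.LFunctions

/-- One-step near lag: for `p + 1 < n` with `n + 1 ≤ 2(p+2)`, the rows `i = p+1 > j = p` give
`(n+1)(node i − node j) = (n+1)·log((p+3)/(p+2)) ∈ [(n+1)/(p+3), (n+1)/(p+2)]`. [folklore] -/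
theorem lag_one_step (n p : ℕ) (hp : p + 1 < n) (htop : ((n : ℝ) + 1) ≤ 2 * ((p : ℝ) + 2)) :
    ∃ i j : Fin n, ((n : ℝ) + 1 ≤ 2 * ((j : ℕ) + 2)) ∧ (j : ℕ) < (i : ℕ) ∧ (i : ℕ) ≤ (j : ℕ) + 6 ∧
      ((n : ℝ) + 1) / ((p : ℝ) + 3) ≤ ((n : ℝ) + 1) * (node n i - node n j) ∧
      ((n : ℝ) + 1) * (node n i - node n j) ≤ ((n : ℝ) + 1) / ((p : ℝ) + 2) := by
  have hpn : p < n := by omega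
  refine ⟨⟨p + 1, hp⟩, ⟨p, hpn⟩, ?_, ?_, ?_, ?_⟩
  · show ((n : ℝ) + 1) ≤ 2 * (((p : ℕ) : ℝ) + 2)
    exact htop
  · show p < p + 1
    omega
  · show p + 1 ≤ p + 6
    omega
  · have hN : (0 : ℝ) < (n : ℝ) + 1 := by positivity
    have hp0 : (0 : ℝ) ≤ (p : ℝ) := Nat.cast_nonneg p
    have hlag : node n ⟨p + 1, hp⟩ - node n ⟨p, hpn⟩
        = Real.log (((p : ℝ) + 3) / ((p : ℝ) + 2)) := by
      simp only [node]
      push_cast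
      rw [Real.log_div (by positivity) (by positivity)]
      ring_nf
    obtain ⟨hlo, hhi⟩ := IntegerScrew.log_div_sub_one_mem (m := (p : ℝ) + 3) (by linarith)
    have e1 : (p : ℝ) + 3 - 1 = (p : ℝ) + 2 := by ring
    rw [e1] at hlo hhi
    rw [hlag]
    constructor
    · have e2 : ((n : ℝ) + 1) / ((p : ℝ) + 3) = ((n : ℝ) + 1) * (1 / ((p : ℝ) + 3)) :=
        div_eq_mul_one_div _ _
      rw [e2]
      exact mul_le_mul_of_nonneg_left hlo hN.le
    · have e3 : ((n : ℝ) + 1) / ((p : ℝ) + 2) = ((n : ℝ) + 1) * (1 / ((p : ℝ) + 2)) :=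
        div_eq_mul_one_div _ _
      rw [e3]
      exact mul_le_mul_of_nonneg_left hhi hN.le

/-- Two-step near lag: for `p + 2 < n` with `n + 1 ≤ 2(p+2)`, the rows `i = p+2 > j = p` give
`(n+1)(node i − node j) = (n+1)·log((p+4)/(p+2)) ∈ [2(n+1)/(p+4), 2(n+1)/(p+2)]`. [folklore] -/
theorem lag_two_step (n p : ℕ) (hp : p + 2 < n) (htop : ((n : ℝ) + 1) ≤ 2 * ((p : ℝ) + 2)) :
    ∃ i j : Fin n, ((n : ℝ) + 1 ≤ 2 * ((j : ℕ) + 2)) ∧ (j : ℕ) < (i : ℕ) ∧ (i : ℕ) ≤ (j : ℕ) + 6 ∧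
      2 * ((n : ℝ) + 1) / ((p : ℝ) + 4) ≤ ((n : ℝ) + 1) * (node n i - node n j) ∧
      ((n : ℝ) + 1) * (node n i - node n j) ≤ 2 * ((n : ℝ) + 1) / ((p : ℝ) + 2) := by
  have hpn : p < n := by omega
  refine ⟨⟨p + 2, hp⟩, ⟨p, hpn⟩, ?_, ?_, ?_, ?_⟩
  · show ((n : ℝ) + 1) ≤ 2 * (((p : ℕ) : ℝ) + 2)
    exact htop
  · show p < p + 2
    omega
  · show p + 2 ≤ p + 6
    omega
  · have hN : (0 : ℝ) < (n : ℝ) + 1 := by positivity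
    have hp0 : (0 : ℝ) ≤ (p : ℝ) := Nat.cast_nonneg p
    have hx : (0 : ℝ) < ((p : ℝ) + 4) / ((p : ℝ) + 2) := by positivity
    have hlag : node n ⟨p + 2, hp⟩ - node n ⟨p, hpn⟩
        = Real.log (((p : ℝ) + 4) / ((p : ℝ) + 2)) := by
      simp only [node]
      push_cast
      rw [Real.log_div (by positivity) (by positivity)]
      ring_nf
    rw [hlag]
    have hlo : 2 / ((p : ℝ) + 4) ≤ Real.log (((p : ℝ) + 4) / ((p : ℝ) + 2)) := by
      have h := Real.one_sub_inv_le_log_of_pos hx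
      rw [inv_div] at h
      have e : 1 - ((p : ℝ) + 2) / ((p : ℝ) + 4) = 2 / ((p : ℝ) + 4) := by
        field_simp; ring
      linarith
    have hhi : Real.log (((p : ℝ) + 4) / ((p : ℝ) + 2)) ≤ 2 / ((p : ℝ) + 2) := by
      have h := Real.log_le_sub_one_of_pos hx
      have e : ((p : ℝ) + 4) / ((p : ℝ) + 2) - 1 = 2 / ((p : ℝ) + 2) := by
        field_simp; ring
      linarith
    constructor
    · have e : 2 * ((n : ℝ) + 1) / ((p : ℝ) + 4) = ((n : ℝ) + 1) * (2 / ((p : ℝ) + 4)) := by ring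
      rw [e]
      exact mul_le_mul_of_nonneg_left hlo hN.le
    · have e : 2 * ((n : ℝ) + 1) / ((p : ℝ) + 2) = ((n : ℝ) + 1) * (2 / ((p : ℝ) + 2)) := by ring
      rw [e]
      exact mul_le_mul_of_nonneg_left hhi hN.le

set_option maxHeartbeats 400000 in
/-- **L3 holds (RH-free, elementary): the scaled near lags of the top half are dense in `[1, 3]`.**
Threshold `M₀ = ⌈16/δ⌉₊ + 8`; four regimes in `x` (see the module docstring). [folklore] -/
theorem lagDensity_holds : LagDensity := by
  intro δ hδ
  refine ⟨⌈16 / δ⌉₊ + 8, fun n hn x hx1 hx3 => ?_⟩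
  have hn8 : 8 ≤ n + 1 := le_trans (Nat.le_add_left 8 _) hn
  set N : ℝ := (n : ℝ) + 1 with hNdef
  have hN8 : (8 : ℝ) ≤ N := by
    rw [hNdef]; exact_mod_cast hn8
  have hN0 : 0 < N := by linarith
  have hNN : 8 * N ≤ N * N := mul_le_mul_of_nonneg_right hN8 hN0.le
  have hN1 : 0 < N - 1 := by linarith
  have hN2 : 0 < N - 2 := by linarith
  have hx0 : 0 < x := by linarith
  have h16 : 16 / N ≤ δ := by
    have h1 : (16 / δ : ℝ) ≤ (⌈16 / δ⌉₊ : ℕ) := Nat.le_ceil _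
    have h2 : (((⌈16 / δ⌉₊ + 8 : ℕ) : ℕ) : ℝ) ≤ N := by rw [hNdef]; exact_mod_cast hn
    push_cast at h2
    have h3 : 16 / δ ≤ N := by linarith
    rw [div_le_iff₀ hδ] at h3
    rw [div_le_iff₀ hN0]
    linarith
  rcases lt_or_ge x (N / (N - 1)) with hR0 | hR1
  · -- regime 0: `x < N/(N−1)`, one step at the very top, `q = N − 1`
    obtain ⟨p, hp⟩ : ∃ p : ℕ, n = p + 2 := ⟨n - 2, by omega⟩
    have hpR : (p : ℝ) + 3 = N := by
      rw [hNdef]; have : ((n : ℕ) : ℝ) = ((p + 2 : ℕ) : ℝ) := by rw [hp]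
      push_cast at this; linarith
    obtain ⟨i, j, h1, h2, h3, hlo, hhi⟩ :=
      lag_one_step n p (by omega) (by rw [← hNdef]; linarith)
    refine ⟨i, j, h1, h2, h3, ?_⟩
    rw [← hNdef] at hlo hhi
    have e1 : N / ((p : ℝ) + 3) = 1 := by rw [hpR]; field_simp
    have e2 : (p : ℝ) + 2 = N - 1 := by linarith
    rw [e1] at hlo
    rw [e2] at hhi
    have hgap : N / (N - 1) - 1 = 1 / (N - 1) := by field_simp; ring
    have hsmall : 1 / (N - 1) ≤ 16 / N := by
      rw [div_le_div_iff₀ hN1 hN0]; linarith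
    rw [abs_le]
    constructor
    · linarith
    · linarith
  · rcases le_or_gt x 2 with hR1' | hR2
    · -- regime 1: `N/(N−1) ≤ x ≤ 2`, one step, `q = ⌈N/x⌉₊`
      set q : ℕ := ⌈N / x⌉₊ with hq
      have hq1 : N / x ≤ (q : ℝ) := Nat.le_ceil _
      have hq2 : (q : ℝ) < N / x + 1 := Nat.ceil_lt_add_one (by positivity)
      have hNx : N / x ≤ N - 1 := by
        rw [div_le_iff₀ hx0]
        have := (div_le_iff₀ hN1).mp hR1
        linarith
      have hNx2 : N / 2 ≤ N / x := div_le_div_of_nonneg_left hN0.le hx0 hR1'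
      have hqN : (q : ℝ) < N := by linarith
      have hq_half : N / 2 ≤ (q : ℝ) := le_trans hNx2 hq1
      have hq2nat : 2 ≤ q := by
        have : (2 : ℝ) ≤ (q : ℝ) := by linarith
        exact_mod_cast this
      obtain ⟨p, hp⟩ : ∃ p : ℕ, q = p + 2 := ⟨q - 2, by omega⟩
      have hpq : (q : ℝ) = (p : ℝ) + 2 := by rw [hp]; push_cast; ring
      have hpn : p + 1 < n := by
        have h' : (q : ℝ) < (n : ℝ) + 1 := by rw [← hNdef]; exact hqN
        have h'' : q < n + 1 := by exact_mod_cast h'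
        omega
      obtain ⟨i, j, h1, h2, h3, hlo, hhi⟩ :=
        lag_one_step n p hpn (by rw [← hNdef, ← hpq]; linarith)
      refine ⟨i, j, h1, h2, h3, ?_⟩
      rw [← hNdef] at hlo hhi
      have hp1 : (0 : ℝ) < (p : ℝ) + 1 := by positivity
      -- `x ∈ [N/(p+2), N/(p+1)]`
      have hxlo : N / ((p : ℝ) + 2) ≤ x := by
        rw [div_le_iff₀ (by positivity)]
        have := (div_le_iff₀ hx0).mp hq1
        rw [hpq] at this; linarith
      have hxhi : x ≤ N / ((p : ℝ) + 1) := by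
        rw [le_div_iff₀ hp1]
        have h' : (p : ℝ) + 1 < N / x := by linarith
        have := (lt_div_iff₀ hx0).mp h'
        linarith
      -- the mesh `N/(p+1) − N/(p+3) ≤ 16/N`
      have hmesh : N / ((p : ℝ) + 1) - N / ((p : ℝ) + 3) ≤ 16 / N := by
        have e : N / ((p : ℝ) + 1) - N / ((p : ℝ) + 3) = 2 * N / (((p : ℝ) + 1) * ((p : ℝ) + 3)) := by
          field_simp; ring
        rw [e, div_le_div_iff₀ (by positivity) hN0]
        have hp2 : N / 2 ≤ (p : ℝ) + 2 := by linarith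
        have hsq : N / 2 * (N / 2) ≤ ((p : ℝ) + 2) * ((p : ℝ) + 2) :=
          mul_le_mul hp2 hp2 (by positivity) (by positivity)
        linarith
      rw [abs_le]
      constructor
      · linarith
      · linarith
    · rcases lt_or_ge x (2 * N / (N - 2)) with hR2a | hR2b
      · -- regime 2a: `2 < x < 2N/(N−2)`, one step at the middle, `q = ⌈N/2⌉₊`
        set q : ℕ := ⌈N / 2⌉₊ with hq
        have hq1 : N / 2 ≤ (q : ℝ) := Nat.le_ceil _
        have hq2 : (q : ℝ) < N / 2 + 1 := Nat.ceil_lt_add_one (by positivity)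
        have hq2nat : 2 ≤ q := by
          have : (2 : ℝ) ≤ (q : ℝ) := by linarith
          exact_mod_cast this
        obtain ⟨p, hp⟩ : ∃ p : ℕ, q = p + 2 := ⟨q - 2, by omega⟩
        have hpq : (q : ℝ) = (p : ℝ) + 2 := by rw [hp]; push_cast; ring
        have hpn : p + 1 < n := by
          have h3' : (q : ℝ) + 1 < (n : ℝ) + 1 := by rw [← hNdef]; linarith
          have h4 : q + 1 < n + 1 := by exact_mod_cast h3'
          omega
        obtain ⟨i, j, h1, h2, h3, hlo, hhi⟩ :=
          lag_one_step n p hpn (by rw [← hNdef, ← hpq]; linarith)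
        refine ⟨i, j, h1, h2, h3, ?_⟩
        rw [← hNdef] at hlo hhi
        -- `lag ≤ N/(p+2) ≤ 2 < x` and `lag ≥ N/(p+3) ≥ 2N/(N+4)`
        have hup : N / ((p : ℝ) + 2) ≤ 2 := by
          rw [div_le_iff₀ (by positivity)]; linarith
        have hdn : 2 * N / (N + 4) ≤ N / ((p : ℝ) + 3) := by
          rw [div_le_div_iff₀ (by positivity) (by positivity)]
          rw [hpq] at hq2
          have h' : 2 * ((p : ℝ) + 3) ≤ N + 4 := by linarith
          calc 2 * N * ((p : ℝ) + 3) = N * (2 * ((p : ℝ) + 3)) := by ring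
            _ ≤ N * (N + 4) := mul_le_mul_of_nonneg_left h' hN0.le
        have hmesh : 2 * N / (N - 2) - 2 * N / (N + 4) ≤ 16 / N := by
          have e : 2 * N / (N - 2) - 2 * N / (N + 4) = 12 * N / ((N - 2) * (N + 4)) := by
            field_simp; ring
          rw [e, div_le_div_iff₀ (by positivity) hN0]
          linarith
        rw [abs_le]
        constructor
        · linarith
        · linarith
      · -- regime 2b: `2N/(N−2) ≤ x ≤ 3`, two steps, `q = ⌈2N/x⌉₊`
        set q : ℕ := ⌈2 * N / x⌉₊ with hq
        have hq1 : 2 * N / x ≤ (q : ℝ) := Nat.le_ceil _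
        have hq2 : (q : ℝ) < 2 * N / x + 1 := Nat.ceil_lt_add_one (by positivity)
        have hNx : 2 * N / x ≤ N - 2 := by
          rw [div_le_iff₀ hx0]
          have := (div_le_iff₀ hN2).mp hR2b
          linarith
        have hNx3 : 2 * N / 3 ≤ 2 * N / x := div_le_div_of_nonneg_left (by positivity) hx0 hx3
        have hqN : (q : ℝ) < N - 1 := by linarith
        have hq_half : N / 2 ≤ (q : ℝ) := by linarith
        have hq2nat : 2 ≤ q := by
          have : (2 : ℝ) ≤ (q : ℝ) := by linarith
          exact_mod_cast this
        obtain ⟨p, hp⟩ : ∃ p : ℕ, q = p + 2 := ⟨q - 2, by omega⟩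
        have hpq : (q : ℝ) = (p : ℝ) + 2 := by rw [hp]; push_cast; ring
        have hpn : p + 2 < n := by
          have h' : (q : ℝ) + 1 < (n : ℝ) + 1 := by rw [← hNdef]; linarith
          have h'' : q + 1 < n + 1 := by exact_mod_cast h'
          omega
        obtain ⟨i, j, h1, h2, h3, hlo, hhi⟩ :=
          lag_two_step n p hpn (by rw [← hNdef, ← hpq]; linarith)
        refine ⟨i, j, h1, h2, h3, ?_⟩
        rw [← hNdef] at hlo hhi
        have hp1 : (0 : ℝ) < (p : ℝ) + 1 := by positivity
        -- `x ∈ [2N/(p+2), 2N/(p+1)]`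
        have hxlo : 2 * N / ((p : ℝ) + 2) ≤ x := by
          rw [div_le_iff₀ (by positivity)]
          have := (div_le_iff₀ hx0).mp hq1
          rw [hpq] at this; linarith
        have hxhi : x ≤ 2 * N / ((p : ℝ) + 1) := by
          rw [le_div_iff₀ hp1]
          have h' : (p : ℝ) + 1 < 2 * N / x := by linarith
          have := (lt_div_iff₀ hx0).mp h'
          linarith
        have hmesh : 2 * N / ((p : ℝ) + 1) - 2 * N / ((p : ℝ) + 4) ≤ 16 / N := by
          have e : 2 * N / ((p : ℝ) + 1) - 2 * N / ((p : ℝ) + 4)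
              = 6 * N / (((p : ℝ) + 1) * ((p : ℝ) + 4)) := by
            field_simp; ring
          rw [e, div_le_div_iff₀ (by positivity) hN0]
          have hp23' : 2 * N ≤ 3 * ((p : ℝ) + 2) := by
            have hp23 : 2 * N / 3 ≤ (p : ℝ) + 2 := by linarith
            have := (div_le_iff₀ (by norm_num : (0 : ℝ) < 3)).mp hp23; linarith
          have ha' : 2 * N - 3 ≤ 3 * ((p : ℝ) + 1) := by linarith
          have hb' : 2 * N + 6 ≤ 3 * ((p : ℝ) + 4) := by linarith
          have hprod : (2 * N - 3) * (2 * N + 6) ≤ (3 * ((p : ℝ) + 1)) * (3 * ((p : ℝ) + 4)) :=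
            mul_le_mul ha' hb' (by linarith) (by positivity)
          linarith
        rw [abs_le]
        constructor
        · linarith
        · linarith

end Summit.RiemannHypothesis.RiemannHypothesis.Theorems.IntegerScrew.Manifest

end
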